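import Summits.Ventures.PercRepro.RankLevelSetLevelFiveSharp
import Summits.Ventures.PercRepro.S2SharpCoreT
import Summits.Ventures.PercRepro.S2CellsP25T
import Summits.Ventures.PercRepro.S2TailP25T
import Summits.Ventures.PercRepro.S2CoreTwentyFive

/-!
# PercRepro — THEOREM C₅ AT `26`: THE SHARPENED PAIR COUNTS AND LEMMA T′ (p7, gen 3; sub-claim S2)

THEOREM C₅ AT `27` (RankLevelSetLevelFiveSharp) one step further: at `p = 25` the cells `(25, d)`, `6 ≤ d ≤ 25`, close
with the free slack once the triangle count is LEMMA T′ (`s₃ ≤ 1 + d(d − 1)/2`, S2TriangleCountPrime, in place of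
`d(d + 1)/2`) — S2CellsP25T / S2TailP25T on the core `c025_core_five_sharp_cell_t` (S2SharpCoreT); the coranks `≥ 26`
at `p = 25` close by the sum key from `n₀ = 50` (S2CoreTwentyFive). Hence:

* **`c025_five_of_four_sharp_t_from`** — for `P ≥ 25`, level `4` for all `p ≥ P` implies level `5` for all `p ≥ P + 1`;
* **`c025_five_large_sharp26`** — UNCONDITIONAL over the landed tree: C-025 at level `5` for every `p ≥ 26` (level `4`
  from S1's `c025_four_seventeen`); `c025_five_large_sharp26'` is the `C025` spelling.
Axioms: standard.
-/

open scoped Matroid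

namespace PercRepro

namespace S2

/-- **The `p = 25` cells, dispatched**: for every corank `6 ≤ d ≤ 25` some slack `m ≤ 1024` with
`1024·U′(25, d) ≤ (1024 − m)·2^(d−5)·C(30, 5)` and `1024·T′(25 + d, d) ≤ m·2^(25+d)`. -/
theorem cellsP25T (d : ℕ) (hd6 : 6 ≤ d) (hd25 : d ≤ 25) :
    ∃ m : ℕ, m ≤ 1024 ∧
      (1024 * (((25 + d).choose 5 : ℚ) +
      (∑ j ∈ Finset.range (d - 5), (Nat.choose (min 13 ((d + 6) / 2 + 1 - 2)) j : ℚ) / (((j + 1) + 3 * (j + 1).choose 2 : ℕ) : ℚ)) *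
        (((1 + d * (d - 1) / 2) * (25 + d - 3).choose 3 + d * (d + 1) * (d + 2) / 3 * (25 + d - 4).choose 2 + (d + 4).choose 5 * (25 + d - 5) + (d + 5).choose 6 : ℕ) : ℚ) +
      ((∑ j ∈ Finset.range (d - 5), (Nat.choose (min 19 (5 + d) - 6) j : ℚ) / (((j + 1) + 3 * (j + 1).choose 2 : ℕ) : ℚ)) -
        (∑ j ∈ Finset.range (d - 5), (Nat.choose (min 5 (d - 1)) j : ℚ) / (((j + 1) + 3 * (j + 1).choose 2 : ℕ) : ℚ))) *
        (((1 + d * (d - 1) / 2) * (min 19 (5 + d) - 3).choose 3 + d * (d + 1) * (d + 2) / 3 * (min 19 (5 + d) - 4).choose 2 + (d + 4).choose 5 * (min 19 (5 + d) - 5) + (d + 5).choose 6 : ℕ) : ℚ)) ≤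
        ((1024 - m : ℕ) : ℚ) * 2 ^ (d - 5) * ((25 + 5).choose 5 : ℚ)) ∧
      (1024 * ((((25 + d).choose 4 * 2 ^ 6 + (25 + d).choose 3 * 2 ^ 3 + (25 + d).choose 2 * 2 + (25 + d) + 1 : ℕ) : ℚ) +
      (((25 + d).choose 5 : ℚ) + (∑ j ∈ Finset.range (d), (Nat.choose (min 13 ((d + 6) / 2 + 1 - 2)) j : ℚ) / (((j + 1) + 3 * (j + 1).choose 2 : ℕ) : ℚ)) * (((1 + d * (d - 1) / 2) * (25 + d - 3).choose 3 + d * (d + 1) * (d + 2) / 3 * (25 + d - 4).choose 2 + (d + 4).choose 5 * (25 + d - 5) + (d + 5).choose 6 : ℕ) : ℚ) +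
        ((∑ j ∈ Finset.range (d), (Nat.choose (min 19 (5 + d) - 6) j : ℚ) / (((j + 1) + 3 * (j + 1).choose 2 : ℕ) : ℚ)) - (∑ j ∈ Finset.range (d), (Nat.choose (min 5 (d - 1)) j : ℚ) / (((j + 1) + 3 * (j + 1).choose 2 : ℕ) : ℚ))) * (((1 + d * (d - 1) / 2) * (min 19 (5 + d) - 3).choose 3 + d * (d + 1) * (d + 2) / 3 * (min 19 (5 + d) - 4).choose 2 + (d + 4).choose 5 * (min 19 (5 + d) - 5) + (d + 5).choose 6 : ℕ) : ℚ)) +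
      ((∑ j ∈ Finset.range (d + 1), (25 + d).choose j : ℕ) : ℚ)) ≤ (m : ℚ) * 2 ^ (25 + d)) := by
  interval_cases d
  · exact ⟨2, by norm_num, cellP25T_poly_6, cellP25T_tail_6⟩
  · exact ⟨2, by norm_num, cellP25T_poly_7, cellP25T_tail_7⟩
  · exact ⟨3, by norm_num, cellP25T_poly_8, cellP25T_tail_8⟩
  · exact ⟨5, by norm_num, cellP25T_poly_9, cellP25T_tail_9⟩
  · exact ⟨9, by norm_num, cellP25T_poly_10, cellP25T_tail_10⟩
  · exact ⟨15, by norm_num, cellP25T_poly_11, cellP25T_tail_11⟩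
  · exact ⟨25, by norm_num, cellP25T_poly_12, cellP25T_tail_12⟩
  · exact ⟨38, by norm_num, cellP25T_poly_13, cellP25T_tail_13⟩
  · exact ⟨56, by norm_num, cellP25T_poly_14, cellP25T_tail_14⟩
  · exact ⟨79, by norm_num, cellP25T_poly_15, cellP25T_tail_15⟩
  · exact ⟨109, by norm_num, cellP25T_poly_16, cellP25T_tail_16⟩
  · exact ⟨144, by norm_num, cellP25T_poly_17, cellP25T_tail_17⟩
  · exact ⟨185, by norm_num, cellP25T_poly_18, cellP25T_tail_18⟩
  · exact ⟨232, by norm_num, cellP25T_poly_19, cellP25T_tail_19⟩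
  · exact ⟨283, by norm_num, cellP25T_poly_20, cellP25T_tail_20⟩
  · exact ⟨338, by norm_num, cellP25T_poly_21, cellP25T_tail_21⟩
  · exact ⟨395, by norm_num, cellP25T_poly_22, cellP25T_tail_22⟩
  · exact ⟨454, by norm_num, cellP25T_poly_23, cellP25T_tail_23⟩
  · exact ⟨513, by norm_num, cellP25T_poly_24, cellP25T_tail_24⟩
  · exact ⟨570, by norm_num, cellP25T_poly_25, cellP25T_tail_25⟩

end S2

namespace ThmN

open Set

variable {α : Type}

/-- **The `e`-free core at level `5`, rank `25`, corank `6 ≤ d ≤ 25`**: the cell `(25, d)` (S2CellsP25T / S2TailP25T,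
LEMMA T′'s `s₃`) fed to the generic core `c025_core_five_sharp_cell_t`. -/
theorem c025_core_five_twentyfive_cells (M : Matroid α) [M.Finite] (d : ℕ) (hd6 : 6 ≤ d)
    (hd25 : d ≤ 25) (hR : M.eRank = ((25 : ℕ) : ℕ∞)) (hn : M.E.ncard = 25 + d)
    (hfree : ∀ e ∈ M.E, ∃ A ⊆ M.E \ {e}, e ∉ M.closure A ∧ e ∉ M.closure ((M.E \ {e}) \ A)) :
    RLS M 25 5 :=
  c025_core_five_sharp_cell_t M 25 d hd6 hd25 hR hn hfree (S2.cellsP25T d hd6 hd25)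

/-- **THEOREM C₅, GIVEN LEVEL `4` FROM `P ≥ 25`**: level `4` for all `p ≥ P` implies level `5` for all `p ≥ P + 1`. -/
theorem c025_five_of_four_sharp_t_from (P : ℕ) (hP : 25 ≤ P)
    (h4 : ∀ (M : Matroid α) [M.Finite] (p : ℕ), P ≤ p → RLS M p 4) :
    ∀ (M : Matroid α) [M.Finite] (p : ℕ), P + 1 ≤ p → RLS M p 5 := by
  refine S2.rls_five_of_four_of_core P (by omega) h4 ?_
  intro M _ p hP' hR hbig hfree
  rcases Nat.lt_or_ge p 26 with h25 | h26
  · have hp' : p = 25 := by omega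
    subst hp'
    rcases Nat.lt_or_ge M.E.ncard (25 + 26) with h | h
    · exact c025_core_five_twentyfive_cells M (M.E.ncard - 25) (by omega) (by omega) hR (by omega) hfree
    · exact c025_core_five_nineteen_at_twentyfive M (by omega) hfree
  · rcases Nat.lt_or_ge M.E.ncard (p + 26) with h | h
    · exact c025_core_five_sharp_cells M p (M.E.ncard - p) h26 (by omega) (by omega) hR (by omega) hfree
    · rcases Nat.lt_or_ge p 27 with h27 | h27
      · have hp' : p = 26 := by omega
        subst hp'
        exact c025_core_five_nineteen_at_twentysix M (by omega) hfree
      · exact c025_core_five_nineteen M p h27 hR (by omega) hfree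

/-- **THEOREM C₅ AT `26`, UNCONDITIONAL**: every finite matroid satisfies C-025 at level `5` for every `p ≥ 26` (level
`4` from S1's `c025_four_seventeen`). -/
theorem c025_five_large_sharp26 (M : Matroid α) [M.Finite] (p : ℕ) (hp : 26 ≤ p) : RLS M p 5 :=
  c025_five_of_four_sharp_t_from 25 le_rfl (fun M _ p hp => S1.c025_four_seventeen M p (by omega)) M p hp

/-- The level-`5` statement at `p ≥ 26` in the vocabulary of `C025`. -/
theorem c025_five_large_sharp26' (M : Matroid α) [M.Finite] (p : ℕ) (hp : 26 ≤ p) :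
    phiK p 5 * ({A : Set α | A ⊆ M.E ∧ M.eRk A = (p : ℕ∞) ∧ M.eRk (M.E \ A) = (5 : ℕ∞)}.ncard : ℚ) ≤
      ({A : Set α | A ⊆ M.E ∧ (5 : ℕ∞) < M.eRk A ∧ M.eRk A < (p : ℕ∞)}.ncard : ℚ) :=
  c025_five_large_sharp26 M p hp

end ThmN

end PercRepro
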